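import Literature.Analysis.FluidPDE.LeiZhang2011ZoomIn
import Literature.Analysis.FluidPDE.LeiZhang2011ZoomOffAxis
import Literature.Analysis.FluidPDE.LeiZhang2011BlowupCase2
import Literature.Analysis.FluidPDE.KNSSThm53OfWindow
import Literature.Analysis.FluidPDE.KNSSTypeIRateLimit
import HarnessLib

/-!
# Lei–Zhang 2011, Theorem 1.4, Case 2 of the blow-up argument

Analysis/FluidPDE **proofs file** (theorems only: no definitions, no named facts, no `sorry`) on
the discharge path of the named fact
`Literature.Analysis.FluidPDE.LeiZhang2011_regularity_bmoStream` (Z. Lei, Q. S. Zhang,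
J. Funct. Anal. 261 (2011) = arXiv:1011.5066, **Theorem 1.4**; proof §4, Case 2, pp. 12–13).

`case2_false`: if `r_n M_n → ∞` along the near-maxima (taken on the meridian half-plane), the
solutions rescaled about `(t_n, x_n)` (`LeiZhang2011ZoomOffAxis`) converge along a subsequence
(uniform Lipschitz bounds from the `BMO` stream class, pointwise Arzelà–Ascoli) to a continuous
bounded weak ancient solution with weakly divergence-free slices (`isWeaklyDivFree_of_tendsto`),
invariant along `e₂` because the symmetry axes recede
(`eq_of_tendstoLocallyUniformly_of_rot_about`, locally uniform convergence from
`tendstoLocallyUniformly_of_lipschitz_of_tendsto`), with vanishing tangential component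
(`zoomAt_abs_apply_one_le`: `|V₁| ≤ (C₁ + 2|y₁|)/(r_n M_n − |y₀|) → 0`) and with `BMO` stream
functions along the approximating slices; `case2_limit_eq_zero` (planar trace, [KNSS] Thm. 5.1,
the `BMO` endgame) makes the limit vanish up to `t = 0`, contradicting `‖v(0, 0)‖ = 1`. This is
unconditional (no swirl step is needed in Case 2).

## Mathlib / tree search

Skeleton of `KNSS2009_regularity_bound_C_over_r_one` / `KNSSTypeIRateLimit` (Thm. 6.2); reused:
`lipschitzWith_clamp`, `exists_strictMono_tendsto_of_lipschitzWith`,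
`isBoundedWeakNSSolutionOn_of_tendsto`, `VectorCalculus.IsDivFree.isWeaklyDivFree_holds`,
`IsClassicalNSSolutionOn.contDiff_velocity`, Mathlib `Filter.Tendsto.div_atTop`,
`le_of_tendsto_of_tendsto`.

## References

* Z. Lei, Q. S. Zhang, J. Funct. Anal. 261 (2011) = arXiv:1011.5066: Thm. 1.4, proof §4,
  Case 2 (pp. 12–13). [LeiZhang2011]
* G. Koch, N. Nadirashvili, G. Seregin, V. Šverák, Acta Math. 203 (2009) = arXiv:0709.3599,
  proof of Thm. 6.2 (p. 12), Thm. 5.1. [KochNadirashviliSereginSverak2009]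
-/

noncomputable section

open MeasureTheory Set Function Filter Topology TopologicalSpace Metric
open scoped InnerProductSpace RealInnerProductSpace NNReal ENNReal

namespace Literature.Analysis.FluidPDE

open Literature.Analysis.FunctionSpaces SereginSverak2009

/-- **Lei–Zhang 2011, Theorem 1.4, Case 2 (`r_k Q_k → ∞`) leads to a contradiction.** Let
`(u, p)` be a classical solution of the unforced Navier–Stokes system (`ν = 1`) on `(0, T) × ℝ³`
with axisymmetric slices, `|Γ| = |r u^θ| ≤ C₁`, and a stream function with `BMO` slices on
`(0, T)`. Suppose near-maxima `(t_n, x_n)` on the meridian half-plane (`(x_n)₁ = 0`),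
`M_n = ‖u(t_n, x_n)‖ > 0`, are given with `‖u‖ ≤ 2M_n` on `(0, t_n] × ℝ³`, `t_n M_n² ≥ 2`,
`t_n M_n² → ∞` and **`(x_n)₀ M_n → ∞`** (Case 2). Then `False`: the solutions rescaled about
`(t_n, x_n)` converge along a subsequence (uniform Lipschitz bounds from the `BMO` stream
function; pointwise Arzelà–Ascoli) to a bounded weak ancient solution `v`, continuous, with
weakly divergence-free slices, invariant along `e₂` (the axes recede:
`eq_of_tendstoLocallyUniformly_of_rot_about`), with `v₁ ≡ 0` (from `|Γ| ≤ C₁`,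
`zoomAt_abs_apply_one_le`) and with `BMO` stream functions along the approximating slices;
`case2_limit_eq_zero` (planar descent, KNSS Thm. 5.1, the `BMO` endgame) gives `v = 0` up to
`t = 0`, while `‖v(0, 0)‖ = lim ‖V_n(0, 0)‖ = 1`. [cite: LeiZhang2011, Thm. 1.4, proof §4, Case 2 (arXiv pp. 12–13)] -/
theorem case2_false {T : ℝ} {u : ℝ → EuclideanSpace ℝ (Fin 3) → EuclideanSpace ℝ (Fin 3)}
    {p : ℝ → EuclideanSpace ℝ (Fin 3) → ℝ}
    (h : IsClassicalNSSolutionOn (Ioo 0 T) 1 0 u p)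
    (haxi : ∀ t ∈ Ioo 0 T, IsAxisymmetric (u t))
    {C₁ : ℝ} (hΓ : ∀ t ∈ Ioo 0 T, ∀ x, |swirl (u t) x| ≤ C₁)
    {Bs : ℝ → EuclideanSpace ℝ (Fin 3) → EuclideanSpace ℝ (Fin 3)} {Kb : ℝ≥0}
    (hBs : HasBMOStreamFunctionOn (Ioo 0 T) u Bs Kb)
    {tn : ℕ → ℝ} {xn : ℕ → EuclideanSpace ℝ (Fin 3)} (htn : ∀ n, tn n ∈ Ioo 0 T)
    (hx1 : ∀ n, xn n 1 = 0) (hMpos : ∀ n, 0 < ‖u (tn n) (xn n)‖)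
    (hmax : ∀ n, ∀ s ∈ Ioc 0 (tn n), ∀ y, ‖u s y‖ ≤ 2 * ‖u (tn n) (xn n)‖)
    (hA2 : ∀ n, 2 ≤ tn n * ‖u (tn n) (xn n)‖ ^ 2)
    (hAtop : Tendsto (fun n => tn n * ‖u (tn n) (xn n)‖ ^ 2) atTop atTop)
    (hR : Tendsto (fun n => ‖u (tn n) (xn n)‖ * xn n 0) atTop atTop) : False := by
  -- the uniform Lipschitz constant on unit windows at the bound `2`
  obtain ⟨K, hK0, hKprop⟩ :=
    KNSS2009_regularity_boundedWeak_window_holds.lipschitz_of_bmoStream 2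
  set M : ℕ → ℝ := fun n => ‖u (tn n) (xn n)‖ with hMdef
  set c : ℕ → ℝ := fun n => (M n)⁻¹ with hcdef
  have hcpos : ∀ n, 0 < c n := fun n => inv_pos.2 (hMpos n)
  have hceq : ∀ n, c n = ‖u (tn n) (xn n)‖⁻¹ := fun n => rfl
  have hcinv : ∀ n, (c n)⁻¹ = M n := fun n => inv_inv _
  set A : ℕ → ℝ := fun n => -(tn n / c n ^ 2) with hAdef
  set B : ℕ → ℝ := fun n => (T - tn n) / c n ^ 2 with hBdef
  have hAeq : ∀ n, A n = -(tn n * M n ^ 2) := fun n => by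
    simp only [hAdef, hcdef, inv_pow, div_inv_eq_mul]
  have hA2' : ∀ n, A n ≤ -2 := fun n => by rw [hAeq]; linarith [hA2 n]
  have hBpos : ∀ n, 0 < B n := fun n => div_pos (by linarith [(htn n).2]) (pow_pos (hcpos n) 2)
  have hAtend : Tendsto A atTop atBot := by
    have : A = fun n => -(tn n * M n ^ 2) := funext hAeq
    rw [this]
    exact tendsto_neg_atTop_atBot.comp hAtop
  -- the rescaled solutions, centred at the near-maxima
  set V : ℕ → ℝ → EuclideanSpace ℝ (Fin 3) → EuclideanSpace ℝ (Fin 3) :=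
    fun n => c n • stPull (c n ^ 2) (c n) (tn n) (xn n) u with hVdef
  set P : ℕ → ℝ → EuclideanSpace ℝ (Fin 3) → ℝ :=
    fun n => c n ^ 2 • stPull (c n ^ 2) (c n) (tn n) (xn n) p with hPdef
  have hVcl : ∀ n, IsClassicalNSSolutionOn (Ioo (A n) (B n)) 1 0 (V n) (P n) := fun n =>
    zoomAt_isClassicalNSSolutionOn h (hcpos n) (tn n) (xn n)
  have hVbd : ∀ n, ∀ s ∈ Ioc (A n) 0, ∀ y, ‖V n s y‖ ≤ 2 := fun n =>
    zoomAt_norm_le_two (hmax n) (hMpos n) (hceq n)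
  have hVmem : ∀ n, ∀ s ∈ Ioo (A n) (B n), tn n + c n ^ 2 * s ∈ Ioo 0 T := fun n s hs =>
    zoom_time_mem (hcpos n).ne' hs
  have hVstream : ∀ n, HasBMOStreamFunctionOn (Ioo (A n) (B n)) (V n)
      (stPull (c n ^ 2) (c n) (tn n) (xn n) Bs) Kb := fun n =>
    zoomAt_hasBMOStreamFunctionOn hBs (hcpos n).ne' (tn n) (xn n)
  have hVone : ∀ n, ‖V n 0 0‖ = 1 := fun n => norm_zoomAt_apply_zero_zero (hMpos n) (hceq n)
  have hVcont : ∀ n, ContinuousOn (uncurry (V n)) (Ioo (A n) (B n) ×ˢ univ) := fun n =>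
    (hVcl n).smooth_velocity.continuousOn
  have hVsym : ∀ n, ∀ s ∈ Ioo (A n) (B n), ∀ (θ : ℝ) (y : EuclideanSpace ℝ (Fin 3)),
      V n s (EuclideanSpace.single 0 (-((c n)⁻¹ * xn n 0)) +
        rotZ θ (y - EuclideanSpace.single 0 (-((c n)⁻¹ * xn n 0)))) = rotZ θ (V n s y) :=
    fun n s hs θ y => zoomAt_rot_about (hx1 n) (hcpos n).ne' (haxi _ (hVmem n s hs)) θ y
  have hVtan : ∀ n, ∀ s ∈ Ioo (A n) (B n), s ≤ 0 → ∀ y : EuclideanSpace ℝ (Fin 3),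
      |y 0| < M n * xn n 0 → |V n s y 1| ≤ (C₁ + 2 * |y 1|) / (M n * xn n 0 - |y 0|) :=
    fun n s hs hs0 y hy => zoomAt_abs_apply_one_le (hx1 n) (hMpos n) (hceq n)
      (hΓ _ (hVmem n s hs)) (hmax n _ (zoom_time_mem_Ioc (hcpos n).ne' ⟨hs.1, hs0⟩)) hy
  have hVdiv : ∀ n, ∀ s ∈ Ioo (A n) (B n), IsWeaklyDivFree (V n s) := fun n s hs =>
    ((hVcl n).divFree s hs).isWeaklyDivFree_holds
      (((hVcl n).contDiff_velocity hs).of_le (by exact_mod_cast le_top))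
  -- uniform Lipschitz bound on `[A n + 1, 0] × ℝ³`, and the clamped maps
  have hLip : ∀ n, ∀ s ∈ Icc (A n + 1) 0, ∀ t ∈ Icc (A n + 1) 0, ∀ x y,
      ‖V n t x - V n s y‖ ≤ max K 8 * (|t - s| + ‖x - y‖) := fun n =>
    lipschitz_up_to_final_time_of_bmoStream hKprop (hA2' n) (hBpos n) (hVcl n) (hVbd n)
      ⟨_, Kb, hVstream n⟩
  set W : ℕ → ℝ × EuclideanSpace ℝ (Fin 3) → EuclideanSpace ℝ (Fin 3) :=
    fun n z => V n (max (A n + 1) (min z.1 0)) z.2 with hWdef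
  have hK8 : 0 ≤ max K 8 := hK0.trans (le_max_left _ _)
  have hK8pos : 0 < max K 8 := lt_of_lt_of_le (by norm_num) (le_max_right _ _)
  have hWlip : ∀ n, LipschitzWith (Real.toNNReal (2 * max K 8)) (W n) := fun n =>
    lipschitzWith_clamp hK8 (by linarith [hA2' n]) (hLip n)
  have hclamp : ∀ n (r : ℝ), max (A n + 1) (min r 0) ∈ Ioc (A n) 0 := fun n r =>
    ⟨by linarith [le_max_left (A n + 1) (min r 0)],
      max_le (by linarith [hA2' n]) (min_le_right _ _)⟩
  have hWball : ∀ n z, W n z ∈ closedBall (0 : EuclideanSpace ℝ (Fin 3)) 2 := fun n z =>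
    mem_closedBall_zero_iff.2 (hVbd n _ (hclamp n z.1) z.2)
  -- extraction: pointwise convergence of the clamped maps
  obtain ⟨φ, Winf, hφ, hWinflip, -, hWconv⟩ :=
    exists_strictMono_tendsto_of_lipschitzWith W hWlip hWball
  have hAφ : Tendsto (fun m => A (φ m)) atTop atBot := hAtend.comp hφ.tendsto_atTop
  have hevA : ∀ t : ℝ, ∀ᶠ m in atTop, A (φ m) + 1 ≤ t := fun t =>
    (hAφ.eventually (eventually_le_atBot (t - 1))).mono fun m hm => by linarith
  -- the limit field
  set v : ℝ → EuclideanSpace ℝ (Fin 3) → EuclideanSpace ℝ (Fin 3) := fun t x => Winf (t, x)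
    with hvdef
  have hvcont : Continuous (uncurry v) := hWinflip.continuous
  have hVlim : ∀ t ≤ 0, ∀ x, Tendsto (fun m => V (φ m) t x) atTop (𝓝 (v t x)) := by
    intro t ht x
    refine (hWconv (t, x)).congr' ((hevA t).mono fun m hm => ?_)
    show V (φ m) (max (A (φ m) + 1) (min t 0)) x = V (φ m) t x
    rw [min_eq_left ht, max_eq_right hm]
  have hevmem : ∀ t < 0, ∀ᶠ m in atTop, t ∈ Ioo (A (φ m)) (B (φ m)) := fun t ht =>
    (hevA t).mono fun m hm => ⟨by linarith, ht.trans (hBpos _)⟩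
  -- the limit is a bounded weak solution on `(-∞, 0)` with weakly divergence-free slices
  have hweak : IsBoundedWeakNSSolutionOn (Iio 0) isOpen_Iio 1 v := by
    refine isBoundedWeakNSSolutionOn_of_tendsto (A := fun m => A (φ m)) (V := fun m => V (φ m))
      (M := 2) hAφ (fun m => ?_) (fun m => ?_) (fun m s hs y => hVbd (φ m) s ⟨hs.1, hs.2.le⟩ y)
      hvcont (fun t ht x => hVlim t ht.le x)
    · have hcl : IsClassicalNSSolutionOn (Ioo (A (φ m)) 0) 1 0 (V (φ m)) (P (φ m)) :=
        (hVcl (φ m)).mono (Ioo_subset_Ioo_right (hBpos _).le) (uniqueDiffOn_Ioo _ _)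
      exact hcl.isBoundedWeakNSSolutionOn ⟨2, fun s hs y => hVbd (φ m) s ⟨hs.1, hs.2.le⟩ y⟩
    · exact (hVcont (φ m)).mono (prod_mono (Ioo_subset_Ioo_right (hBpos _).le) Subset.rfl)
  have hdiv : ∀ t < 0, IsWeaklyDivFree (v t) :=
    isWeaklyDivFree_of_tendsto (M := 2) (A := fun m => A (φ m)) (V := fun m => V (φ m)) hAφ
      (fun m t ht => hVdiv (φ m) t ⟨ht.1, ht.2.trans (hBpos _)⟩)
      (fun m => (hVcont (φ m)).mono (prod_mono (Ioo_subset_Ioo_right (hBpos _).le) Subset.rfl))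
      (fun m t ht y => hVbd (φ m) t ⟨ht.1, ht.2.le⟩ y) (fun t ht x => hVlim t ht.le x)
  -- at a fixed `t < 0`: the shifted approximating slices converge locally uniformly
  have hshift : ∀ t < 0, ∃ k₀ : ℕ, (∀ k, t ∈ Ioo (A (φ (k + k₀))) (B (φ (k + k₀)))) ∧
      TendstoLocallyUniformly (fun k => V (φ (k + k₀)) t) (v t) atTop ∧
      ∀ r : ℝ, TendstoUniformlyOn (fun k => V (φ (k + k₀)) t) (v t) atTop
        (closedBall (0 : EuclideanSpace ℝ (Fin 3)) r) := by
    intro t ht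
    obtain ⟨k₀, hk₀⟩ := eventually_atTop.1 ((hevmem t ht).and (hevA t))
    have hmem : ∀ k, t ∈ Ioo (A (φ (k + k₀))) (B (φ (k + k₀))) := fun k =>
      (hk₀ (k + k₀) (by omega)).1
    have hAk : ∀ k, A (φ (k + k₀)) + 1 ≤ t := fun k => (hk₀ (k + k₀) (by omega)).2
    have hconvpt : ∀ x, Tendsto (fun k => V (φ (k + k₀)) t x) atTop (𝓝 (v t x)) := fun x =>
      (hVlim t ht.le x).comp (tendsto_add_atTop_nat k₀)
    have hlipx : ∀ k x y, ‖V (φ (k + k₀)) t x - V (φ (k + k₀)) t y‖ ≤ max K 8 * ‖x - y‖ :=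
      fun k x y => by
        have := hLip (φ (k + k₀)) t ⟨hAk k, ht.le⟩ t ⟨hAk k, ht.le⟩ x y
        simpa using this
    exact ⟨k₀, hmem, tendstoLocallyUniformly_of_lipschitz_of_tendsto hK8pos hlipx hconvpt⟩
  -- invariance along `e₂`: the axes recede
  have hinv : ∀ t < 0, ∀ (x : EuclideanSpace ℝ (Fin 3)) (δ : ℝ),
      v t (x + EuclideanSpace.single 1 δ) = v t x := by
    intro t ht x δ
    obtain ⟨k₀, hmem, hLU, -⟩ := hshift t ht
    have hRk : Tendsto (fun k => (c (φ (k + k₀)))⁻¹ * xn (φ (k + k₀)) 0) atTop atTop := by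
      simp only [hcinv]
      exact hR.comp (hφ.tendsto_atTop.comp (tendsto_add_atTop_nat k₀))
    exact eq_of_tendstoLocallyUniformly_of_rot_about hRk
      (fun k θ y => hVsym (φ (k + k₀)) t (hmem k) θ y) hLU
      (hvcont.comp (Continuous.prodMk_right t)) x δ
  -- the tangential component vanishes in the limit
  have htan : ∀ t < 0, ∀ x, v t x 1 = 0 := by
    intro t ht x
    obtain ⟨k₀, hmem, -, -⟩ := hshift t ht
    have hRk : Tendsto (fun k => M (φ (k + k₀)) * xn (φ (k + k₀)) 0) atTop atTop :=
      hR.comp (hφ.tendsto_atTop.comp (tendsto_add_atTop_nat k₀))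
    have hlim1 : Tendsto (fun k => |V (φ (k + k₀)) t x 1|) atTop (𝓝 |v t x 1|) :=
      (((PiLp.continuous_apply 2 _ 1).tendsto _).comp
        ((hVlim t ht.le x).comp (tendsto_add_atTop_nat k₀))).abs
    have hbound : Tendsto (fun k => (C₁ + 2 * |x 1|) / (M (φ (k + k₀)) * xn (φ (k + k₀)) 0 - |x 0|))
        atTop (𝓝 0) := by
      refine Tendsto.div_atTop tendsto_const_nhds ?_
      simpa only [sub_eq_add_neg] using tendsto_atTop_add_const_right _ (-|x 0|) hRk
    have hev : ∀ᶠ k in atTop, |V (φ (k + k₀)) t x 1| ≤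
        (C₁ + 2 * |x 1|) / (M (φ (k + k₀)) * xn (φ (k + k₀)) 0 - |x 0|) := by
      filter_upwards [hRk.eventually (eventually_gt_atTop |x 0|)] with k hk
      exact hVtan (φ (k + k₀)) t (hmem k) ht.le x hk
    have h0 : |v t x 1| ≤ 0 := le_of_tendsto_of_tendsto hlim1 hbound hev
    exact abs_nonpos_iff.1 h0
  -- `BMO` stream functions along the approximating slices
  have happrox : ∀ t < 0, ∃ (w B' : ℕ → EuclideanSpace ℝ (Fin 3) → EuclideanSpace ℝ (Fin 3))
      (K' : ℝ≥0), (∀ k, Differentiable ℝ (B' k)) ∧ (∀ k, curl (B' k) =ᵐ[volume] w k) ∧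
      (∀ k, eBMOSeminormVec (B' k) ≤ K') ∧ (∀ k, LocallyIntegrable (w k) volume) ∧
      ∀ r : ℝ, 0 < r →
        TendstoUniformlyOn w (v t) atTop (closedBall (0 : EuclideanSpace ℝ (Fin 3)) r) := by
    intro t ht
    obtain ⟨k₀, hmem, -, hU⟩ := hshift t ht
    have hstr : ∀ k, Differentiable ℝ (stPull (c (φ (k + k₀)) ^ 2) (c (φ (k + k₀)))
        (tn (φ (k + k₀))) (xn (φ (k + k₀))) Bs t) ∧
        curl (stPull (c (φ (k + k₀)) ^ 2) (c (φ (k + k₀))) (tn (φ (k + k₀))) (xn (φ (k + k₀)))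
          Bs t) =ᵐ[volume] V (φ (k + k₀)) t ∧
        eBMOSeminormVec (stPull (c (φ (k + k₀)) ^ 2) (c (φ (k + k₀))) (tn (φ (k + k₀)))
          (xn (φ (k + k₀))) Bs t) ≤ Kb := fun k => hVstream (φ (k + k₀)) t (hmem k)
    have hwc : ∀ k, Continuous (V (φ (k + k₀)) t) := fun k =>
      (hVcont (φ (k + k₀))).comp_continuous (Continuous.prodMk_right t)
        fun x => ⟨hmem k, mem_univ x⟩
    exact ⟨fun k => V (φ (k + k₀)) t, fun k => stPull (c (φ (k + k₀)) ^ 2) (c (φ (k + k₀)))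
        (tn (φ (k + k₀))) (xn (φ (k + k₀))) Bs t, Kb, fun k => (hstr k).1,
      fun k => (hstr k).2.1, fun k => (hstr k).2.2, fun k => (hwc k).locallyIntegrable,
      fun r _ => hU r⟩
  -- Case 2 for the limit: `v = 0` up to `t = 0`
  have hv0 := case2_limit_eq_zero hweak hvcont hdiv hinv htan happrox
  -- but `‖v(0, 0)‖ = lim ‖V_n(0, 0)‖ = 1`
  have hnorm1 : ‖Winf (0, 0)‖ = 1 := by
    have h1 : Tendsto (fun m => ‖W (φ m) (0, 0)‖) atTop (𝓝 ‖Winf (0, 0)‖) := (hWconv (0, 0)).norm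
    have h2 : ∀ m, ‖W (φ m) (0, 0)‖ = 1 := fun m => by
      show ‖V (φ m) (max (A (φ m) + 1) (min 0 0)) 0‖ = 1
      rw [min_self, max_eq_right (by linarith [hA2' (φ m)])]
      exact hVone (φ m)
    refine tendsto_nhds_unique h1 ?_
    simp_rw [h2]
    exact tendsto_const_nhds
  have hv0' : Winf (0, 0) = 0 := hv0 0 le_rfl 0
  rw [hv0', norm_zero] at hnorm1
  exact zero_ne_one hnorm1

end Literature.Analysis.FluidPDE
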